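import Summits.Ventures.CertifiedArithmetic.LowPrec.DoubleRoundingDivision

/-!
# Double rounding of quotients — the named cells (THEOREM D-div, matrix level)

HONEST FRAMING: certified error envelopes and provably optimal rounding/accumulation schemes for
low-precision formats under stated cost models; every table by two implementations; no hardware
or vendor claims.

`DRDiv X Y`: ONE division of `X`-data executed (correctly rounded) in `Y` and converted to `X`
equals the correctly rounded quotient of `X` (`DoubleRoundingDivision.lean`; saturating
round-to-nearest-even, subnormals kept; `a / 0 = 0` in `ℚ` makes the divisor `0` vacuous,
`drDiv_iff_ne_zero`). This file decides it on the `13 × 13` matrix of named records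
(`drDiv_named_iff`: `DRDiv X Y ↔ (X, Y) ∈ drDivPairs`, `51` pairs, `38` off the diagonal) and,
equivalently, as ONE boolean evaluation of the parameter test `drDivTest` (identical ∨ same grid
with larger top ∨ the quotient clause (Q)) — on these records clause (Q) is not only sufficient
but, together with (I) and (G), exactly right:

* (Q) `36` cells (`drDiv_of_clause`): every FP8 record (e4m3, e5m2, binary8p3/p4/p5, binary8p3f
  = fnuz e5m2, binary8p4f = fnuz e4m3) → binary16 / binary32, and → bfloat16 except binary8p5;
  e3m2, e2m3 → binary16 / bfloat16 / binary32; e2m1 → every named format of precision `≥ 4`;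
  binary16, bfloat16 → binary32. Two of them, binary8p3 / binary8p3f → binary16, have
  `bias_X = 16 > 15 = bias_Y` (the clause is bias-free); one, e2m1 → e2m3 (`L_Y + P_X = L_X`),
  lies outside the gradual-underflow hypothesis `emin₂ ≤ emin₁ - p₁ - 2` of [Roux2014, Table II];
* (G) binary8p3 → binary8p3f, binary8p4 → binary8p4f (same grid, larger top:
  `toRat_roundNE_roundNE_of_sameGrid`); (I) the `13` diagonal cells;
* the other `16` embedded cells FAIL (`P_Y < 2 P_X`), by one kernel-evaluated witness pair each
  (`drDivWit`): e2m1 → the precision-3 formats (`2 ÷ 3/2 = 4/3 ↦ 5/4 ↦ 1`, directly `3/2`);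
  e3m2 → the precision-4 FP8 formats (`1/4 ÷ 3/8`) and the precision-3 ones (`1/16 ÷ 3/8`,
  subnormal range of e3m2); e2m3 → e4m3 / binary8p4 / binary8p4f (`1/4 ÷ 3/8 = 2/3 ↦ 11/16 ↦ 3/4`,
  directly `5/8`; subnormal in e2m3, whose least normal value is `1`) and → binary8p5
  (`3/2 ÷ 9/8`); e5m2 → binary8p3f (`2^-16 ÷ 3/8`); binary8p5 → bfloat16
  (`1/8 ÷ 31/128 = 16/31 ↦ 33/64 ↦ 1/2`, directly `17/32`);
* the `102` non-embedded cells fail already on `a ÷ 1` (round trip, `RoundTripDecision.lean`).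

§5: the underflow hypothesis `L_Y + P_X ≤ L_X` of clause (Q) is SHARP — with `P_Y = 2 P_X` and
`L_Y = L_X - P_X + 1` the double rounding of e2m3 resp. e2m1 quotients through the toy records
`⟨7, 0, 8, 127⟩` resp. `⟨3, 0, 8, 7⟩` slips (`1/8 ÷ 15/8 = 1/15 ↦ 1/16 ↦ 0`, directly `1/8`),
while through `⟨7, 1, 8, 127⟩` resp. `⟨3, 1, 8, 7⟩` (`L_Y = L_X - P_X`) it is innocuous
(`drDiv_underflow_clause_sharp`).

Implementation A: `code/enum/doublediv_decision.py` → `DOUBLE-ROUNDING-DIV.md`,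
`certs/enum/DOUBLE-ROUNDING-DIV.json` (brute force over all positive operand pairs of every cell
with an FP4 / FP6 / FP8 source, structured samples for the 16-bit sources, two independent exact
RNE implementations, `0` disagreements with the clause; the list `drDivPairs` and the table
`drDivWitTable` below are transcribed from that certificate). PLACEMENT as in
`DoubleRoundingDivision.lean` ([Figueroa1995, §3]; [Roux2014, Thm 29, Remark 30, Table II]).
No hardware or vendor claims.
-/

namespace Summit.Ventures.CertifiedArithmetic

open Literature.ComputerArithmetic.FloatingPoint
open Literature.ComputerArithmetic.FloatingPoint.Format
open Literature.ComputerArithmetic.FloatingPoint.MiniFloat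

/-! ## §1 The property and its generic cells -/

/-- `DRDiv φ ψ`: for all finite `a b` of `φ`, `fl_φ (fl_ψ (a / b)) = fl_φ (a / b)` (one division in
`ψ`, converted to `φ`, is the correctly rounded quotient of `φ`; saturating RNE, subnormals kept;
`b = 0` is vacuous since `a / 0 = 0`). [this packet; cite: Figueroa1995, §3] -/
def DRDiv (φ ψ : Format) : Prop :=
  ∀ a b : MiniFloat φ, (roundNE φ (roundNE ψ (a.toRat / b.toRat)).toRat).toRat
    = (roundNE φ (a.toRat / b.toRat)).toRat

/-- The divisor-`0` instances are vacuous: `DRDiv` is the statement over `b ≠ 0`. [folklore] -/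
theorem drDiv_iff_ne_zero {φ ψ : Format} : DRDiv φ ψ ↔ ∀ a b : MiniFloat φ, b.toRat ≠ 0 →
    (roundNE φ (roundNE ψ (a.toRat / b.toRat)).toRat).toRat
      = (roundNE φ (a.toRat / b.toRat)).toRat :=
  ⟨fun h a b _ => h a b, fun h a b => by
    by_cases hb : b.toRat = 0
    · simp only [hb, div_zero, toRat_roundNE_zero]
    · exact h a b hb⟩

/-- `DRDiv` implies the round trip when `1` is a value of `φ` (`b = 1`). [folklore] -/
theorem roundTrips_of_drDiv {φ ψ : Format} (hone : ∃ o : MiniFloat φ, o.toRat = 1)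
    (h : DRDiv φ ψ) : RoundTrips φ ψ := fun x => by
  obtain ⟨o, ho⟩ := hone
  have := h x o
  rwa [ho, div_one, toRat_roundNE_toRat] at this

/-- Witness replay: two rationals pushed through `fl_φ` are operands; if the two routes differ on
their quotient, `DRDiv φ ψ` fails. [folklore] -/
theorem not_drDiv_of_ne {φ ψ : Format} (ra rb : ℚ)
    (h : (roundNE φ (roundNE ψ ((roundNE φ ra).toRat / (roundNE φ rb).toRat)).toRat).toRat
      ≠ (roundNE φ ((roundNE φ ra).toRat / (roundNE φ rb).toRat)).toRat) :
    ¬ DRDiv φ ψ := fun hall => h (hall _ _)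

/-- THEOREM D-div AS A BOOLEAN TEST on parameter records: (I) `φ = ψ`, or (G) same grid with a
larger top, or (Q) the quotient clause of `drDiv_of_clause`. Certified below to be exactly right
on the named pairs. [this packet] -/
def drDivTest (φ ψ : Format) : Bool :=
  decide (φ = ψ) ||
  (decide (ψ.manBits = φ.manBits) && decide (ψ.emaxCode = φ.emaxCode) && decide (ψ.bias = φ.bias)
    && decide (φ.maxScaled ≤ ψ.maxScaled)) ||
  (embedsTest φ ψ && decide (2 * φ.manBits + 1 ≤ ψ.manBits)
    && decide (ψ.qexp + φ.manBits + 1 ≤ φ.qexp) && decide (1 ≤ φ.manBits))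

/-- The test is sound for EVERY pair of records. [this packet] -/
theorem drDiv_of_test {φ ψ : Format} (h : drDivTest φ ψ = true) : DRDiv φ ψ := by
  simp only [drDivTest, Bool.or_eq_true, Bool.and_eq_true, decide_eq_true_eq] at h
  rcases h with (rfl | ⟨⟨⟨hm, he⟩, hb⟩, hM⟩) | ⟨⟨⟨hE, hm⟩, hD⟩, h1⟩
  · exact fun a b => toRat_roundNE_toRat _
  · exact fun a b => toRat_roundNE_roundNE_of_sameGrid hm he hb hM _
  · exact drDiv_of_clause hE hm hD h1

/-! ## §2 The matrix and the witnesses (transcribed from implementation A's certificate) -/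

/-- THE MATRIX (THEOREM D-div on the named records): the `51` ordered pairs `(X, Y)` with
`DRDiv X Y`, in the order of `namedFormats`. [this packet] -/
def drDivPairs : List (Format × Format) := [
  (E2M1, E2M1), (E2M1, E2M3), (E2M1, E4M3), (E2M1, Binary8p4), (E2M1, Binary8p5),
  (E2M1, Binary8p4F), (E2M1, Binary16), (E2M1, BFloat16), (E2M1, Binary32), (E3M2, E3M2),
  (E3M2, Binary16), (E3M2, BFloat16), (E3M2, Binary32), (E2M3, E2M3), (E2M3, Binary16),
  (E2M3, BFloat16), (E2M3, Binary32), (E4M3, E4M3), (E4M3, Binary16), (E4M3, BFloat16),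
  (E4M3, Binary32), (E5M2, E5M2), (E5M2, Binary16), (E5M2, BFloat16), (E5M2, Binary32),
  (Binary8p3, Binary8p3), (Binary8p3, Binary8p3F), (Binary8p3, Binary16), (Binary8p3, BFloat16),
  (Binary8p3, Binary32), (Binary8p4, Binary8p4), (Binary8p4, Binary8p4F), (Binary8p4, Binary16),
  (Binary8p4, BFloat16), (Binary8p4, Binary32), (Binary8p5, Binary8p5), (Binary8p5, Binary16),
  (Binary8p5, Binary32), (Binary8p3F, Binary8p3F), (Binary8p3F, Binary16), (Binary8p3F, BFloat16),
  (Binary8p3F, Binary32), (Binary8p4F, Binary8p4F), (Binary8p4F, Binary16), (Binary8p4F, BFloat16),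
  (Binary8p4F, Binary32), (Binary16, Binary16), (Binary16, Binary32), (BFloat16, BFloat16),
  (BFloat16, Binary32), (Binary32, Binary32)]

/-- `51` cells, `38` off the diagonal. -/
theorem drDivPairs_length :
    drDivPairs.length = 51 ∧ (drDivPairs.filter fun p => decide (p.1 ≠ p.2)).length = 38 := by
  decide

/-- THE MATRIX IS THE TEST: on the named pairs `drDivPairs` is exactly the filter of `drDivTest`
(implementation B of the parameter law; A tabulates the same `51` cells). [this packet] -/
theorem drDivPairs_eq_filter : drDivPairs = namedPairs.filter (fun p => drDivTest p.1 p.2) := by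
  decide +kernel

/-- The witness table of the `16` failing embedded named cells: `(X, Y, a, b)` with `a b` values
of `X` (found by implementation A as the first slip of its scan, replayed there through two exact
RNE implementations and here through the kernel). [this packet] -/
def drDivWitTable : List (Format × Format × ℚ × ℚ) := [
  (E2M1, E3M2, 2, 3 / 2),
  (E2M1, E5M2, 2, 3 / 2),
  (E2M1, Binary8p3, 2, 3 / 2),
  (E2M1, Binary8p3F, 2, 3 / 2),
  (E3M2, E4M3, 1 / 4, 3 / 8),
  (E3M2, E5M2, 1 / 16, 3 / 8),
  (E3M2, Binary8p3, 1 / 16, 3 / 8),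
  (E3M2, Binary8p4, 1 / 4, 3 / 8),
  (E3M2, Binary8p3F, 1 / 16, 3 / 8),
  (E3M2, Binary8p4F, 1 / 4, 3 / 8),
  (E2M3, E4M3, 1 / 4, 3 / 8),
  (E2M3, Binary8p4, 1 / 4, 3 / 8),
  (E2M3, Binary8p5, 3 / 2, 9 / 8),
  (E2M3, Binary8p4F, 1 / 4, 3 / 8),
  (E5M2, Binary8p3F, 1 / 65536, 3 / 8),
  (Binary8p5, BFloat16, 1 / 8, 31 / 128)]

/-- The witness pair of a cell (`(0, 0)` off the table). [this packet] -/
def drDivWit (X Y : Format) : ℚ × ℚ :=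
  ((drDivWitTable.find? fun e => decide (e.1 = X ∧ e.2.1 = Y)).map (·.2.2)).getD (0, 0)

/-! ## §3 Cell forms -/

/-- Every named format holds the value `1`. -/
theorem exists_toRat_eq_one_of_mem_namedFormats :
    ∀ X ∈ namedFormats, ∃ o : MiniFloat X, o.toRat = 1 := by
  intro X hX
  simp only [namedFormats, List.mem_cons, List.not_mem_nil, or_false] at hX
  rcases hX with rfl | rfl | rfl | rfl | rfl | rfl | rfl | rfl | rfl | rfl | rfl | rfl | rfl <;>
    exact ⟨roundNE _ 1, by decide +kernel⟩

/-- Cell form (I)/(G)/(Q): the test holds. -/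
theorem dvCellT {X Y : Format} (h : drDivTest X Y = true) (hm : (X, Y) ∈ drDivPairs) :
    DRDiv X Y ↔ (X, Y) ∈ drDivPairs := iff_of_true (drDiv_of_test h) hm

/-- Cell form (N): a non-embedded named pair (embedding test `false`; round trip = embedding on
the named pairs, `RoundTripDecision.lean`; `1` is a value of `X`). -/
theorem dvCellN {X Y : Format} (hX : X ∈ namedFormats) (hY : Y ∈ namedFormats)
    (hone : ∃ o : MiniFloat X, o.toRat = 1) (he : embedsTest X Y = false)
    (hm : (X, Y) ∉ drDivPairs) : DRDiv X Y ↔ (X, Y) ∈ drDivPairs :=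
  iff_of_false (fun h => not_embeds_of_test (stdOperand_of_mem_namedFormats X hX) he
    ((roundTrips_named_iff_embeds hX hY).mp (roundTrips_of_drDiv hone h))) hm

/-- Cell form (W): a failing embedded pair, by its tabulated witness. -/
theorem dvCellW {X Y : Format}
    (h : (roundNE X (roundNE Y ((roundNE X (drDivWit X Y).1).toRat
        / (roundNE X (drDivWit X Y).2).toRat)).toRat).toRat
      ≠ (roundNE X ((roundNE X (drDivWit X Y).1).toRat / (roundNE X (drDivWit X Y).2).toRat)).toRat)
    (hm : (X, Y) ∉ drDivPairs) : DRDiv X Y ↔ (X, Y) ∈ drDivPairs :=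
  iff_of_false (not_drDiv_of_ne _ _ h) hm

/-! ## §4 THEOREM D-div on the named formats -/

set_option maxHeartbeats 8000000 in
/-- THEOREM D-div (the named formats): for named `X`, `Y`, one division in `Y` converted to `X` is
the correctly rounded quotient of `X` iff `(X, Y)` is one of the `51` pairs of `drDivPairs`. Each
of the `169` cells is closed by the engine its class names: the test (I)/(G)/(Q), non-embedding,
or one witness. -/
theorem drDiv_named_iff {X Y : Format} (hX : X ∈ namedFormats) (hY : Y ∈ namedFormats) :
    DRDiv X Y ↔ (X, Y) ∈ drDivPairs := by
  simp only [namedFormats, List.mem_cons, List.not_mem_nil, or_false] at hX hY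
  rcases hX with rfl | rfl | rfl | rfl | rfl | rfl | rfl | rfl | rfl | rfl | rfl | rfl | rfl <;>
  rcases hY with rfl | rfl | rfl | rfl | rfl | rfl | rfl | rfl | rfl | rfl | rfl | rfl | rfl
  all_goals first
    | exact dvCellT (by decide +kernel) (by decide +kernel)
    | exact dvCellN (by decide) (by decide) (exists_toRat_eq_one_of_mem_namedFormats _ (by decide))
        (by decide +kernel) (by decide +kernel)
    | exact dvCellW (by decide +kernel) (by decide +kernel)

/-- THEOREM D-div AS ONE BOOLEAN EVALUATION: for named `X`, `Y`, `DRDiv X Y ↔ drDivTest X Y`. -/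
theorem drDiv_named_iff_test {X Y : Format} (hX : X ∈ namedFormats) (hY : Y ∈ namedFormats) :
    DRDiv X Y ↔ drDivTest X Y = true := by
  rw [drDiv_named_iff hX hY, drDivPairs_eq_filter, List.mem_filter]
  exact ⟨fun h => h.2, fun h => ⟨mem_namedPairs hX hY, h⟩⟩

/-- Corollary: a correctly emulated division needs `F_X ⊆ F_Y`. -/
theorem embeds_of_drDiv_named {X Y : Format} (hX : X ∈ namedFormats) (hY : Y ∈ namedFormats)
    (h : DRDiv X Y) : Embeds X Y :=
  (roundTrips_named_iff_embeds hX hY).mp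
    (roundTrips_of_drDiv (exists_toRat_eq_one_of_mem_namedFormats X hX) h)

/-! ### Readings (kernel instances; statements about the formats' arithmetic only) -/

/-- Through binary32, binary16 and bfloat16: the division of every FP8 record is correctly
emulated by ONE wide division converted back — except binary8p5 through bfloat16 … -/
example : DRDiv E4M3 Binary32 ∧ DRDiv E5M2 Binary32 ∧ DRDiv E4M3 Binary16 ∧ DRDiv E5M2 Binary16 ∧
    DRDiv E4M3 BFloat16 ∧ DRDiv E5M2 BFloat16 ∧ DRDiv Binary8p3 Binary16 ∧
    DRDiv Binary8p4 BFloat16 ∧ DRDiv Binary8p5 Binary16 ∧ DRDiv Binary16 Binary32 ∧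
    DRDiv BFloat16 Binary32 :=
  ⟨drDiv_of_test (by decide +kernel), drDiv_of_test (by decide +kernel),
    drDiv_of_test (by decide +kernel), drDiv_of_test (by decide +kernel),
    drDiv_of_test (by decide +kernel), drDiv_of_test (by decide +kernel),
    drDiv_of_test (by decide +kernel), drDiv_of_test (by decide +kernel),
    drDiv_of_test (by decide +kernel), drDiv_of_test (by decide +kernel),
    drDiv_of_test (by decide +kernel)⟩

/-- … (`P = 8 < 2·5`: `1/8 ÷ 31/128 = 16/31 ↦ 33/64 ↦ 1/2`, directly `17/32`), and no FP6
division is emulated through an FP8 format, nor e2m1's through a precision-3 one. -/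
example : ¬ DRDiv Binary8p5 BFloat16 ∧ ¬ DRDiv E3M2 E4M3 ∧ ¬ DRDiv E2M3 E4M3 ∧
    ¬ DRDiv E2M3 Binary8p5 ∧ ¬ DRDiv E2M1 E5M2 ∧ DRDiv E2M1 E4M3 ∧ DRDiv E2M1 E2M3 :=
  ⟨fun h => absurd ((drDiv_named_iff (by decide) (by decide)).mp h) (by decide +kernel),
    fun h => absurd ((drDiv_named_iff (by decide) (by decide)).mp h) (by decide +kernel),
    fun h => absurd ((drDiv_named_iff (by decide) (by decide)).mp h) (by decide +kernel),
    fun h => absurd ((drDiv_named_iff (by decide) (by decide)).mp h) (by decide +kernel),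
    fun h => absurd ((drDiv_named_iff (by decide) (by decide)).mp h) (by decide +kernel),
    drDiv_of_test (by decide +kernel), drDiv_of_test (by decide +kernel)⟩

/-! ## §5 The underflow hypothesis of clause (Q) is sharp -/

/-- SHARPNESS OF `L_Y + P_X ≤ L_X` (toy records, `P_Y = 2 P_X`): with `L_Y = L_X - P_X + 1`
(records `⟨7, 0, 8, 127⟩` for e2m3, `⟨3, 0, 8, 7⟩` for e2m1) the quotient double rounding slips
— `1/8 ÷ 15/8 = 1/15 ↦ 1/16 ↦ 0` against `fl_e2m3 (1/15) = 1/8`, `1/2 ÷ 3/2 = 1/3 ↦ 1/4 ↦ 0`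
against `fl_e2m1 (1/3) = 1/2` (implementation A: `27 / 961` resp. `8 / 49` positive pairs slip)
—, with `L_Y = L_X - P_X` (`⟨7, 1, 8, 127⟩`, `⟨3, 1, 8, 7⟩`) it is innocuous by clause (Q). So
the clause's underflow hypothesis, two below [Roux2014, Table II]'s `emin₂ ≤ emin₁ - p₁ - 2`,
cannot be weakened further for ties-to-even. [this packet] -/
theorem drDiv_underflow_clause_sharp :
    ¬ DRDiv E2M3 ⟨7, 0, 8, 127, by decide⟩ ∧ DRDiv E2M3 ⟨7, 1, 8, 127, by decide⟩ ∧
    ¬ DRDiv E2M1 ⟨3, 0, 8, 7, by decide⟩ ∧ DRDiv E2M1 ⟨3, 1, 8, 7, by decide⟩ :=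
  ⟨not_drDiv_of_ne (1 / 8) (15 / 8) (by decide +kernel), drDiv_of_test (by decide +kernel),
    not_drDiv_of_ne (1 / 2) (3 / 2) (by decide +kernel), drDiv_of_test (by decide +kernel)⟩

end Summit.Ventures.CertifiedArithmetic
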